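import Summits.HubbardSuperconductivity.HubbardSuperconductivity.Theorems.AposterioriCapRgSeededBrokenRegimeBoseFermiPinnedPolchinskiSeedFlow
import Summits.HubbardSuperconductivity.HubbardSuperconductivity.Theorems.AposterioriCapRgSeededBrokenRegimeBoseFermiPinnedPolchinskiBilinearBound
import Summits.HubbardSuperconductivity.HubbardSuperconductivity.Theorems.AposterioriCapRgSeededBrokenRegimeBoseFermiPinnedLegKernelNormSmul
import Summits.HubbardSuperconductivity.HubbardSuperconductivity.Theorems.AposterioriCapRgSeededBrokenRegimeBoseFermiPinnedFlowStep

/-!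
# One RG integration step of the Wilsonian effective action in the leg-weighted `L¹–L^∞` norm
# (crux `SeededBrokenRegimeBoseFermiPinned` = stmt-HubbardSuperconductivity-14047, route AposterioriCapRg; supports, lead c4)

Restatement-invariant analysis layer, assembly (registered stub `stub_effActionStepLe`).  Along the LINEAR covariance
path `C_s = C₀ + s C'`, `s ∈ [0, 1]` (one slice of a scale decomposition), for an even interaction `V` whose normalised
partition functions do not vanish on the path, the Wilsonian effective action `𝒢_s = effAction (C_s) V` satisfies
Polchinski's equation weakly (`hasDerivAt_apply_effAction`, landed by lead c3); its right-hand side is bounded in the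
leg-weighted norm of Salmhofer's kernels by the contraction estimate (`LaplacianNormBound.legKernelNorm_laplacian_le`)
and the tree-line estimate (`PolchinskiBilinearBound.legKernelNorm_polchinskiBilinear_le`) — the vacuum term `(Ż/Z)·1`
has no kernels in positive degree (`weightedKernel_smul_one_succ`) — and the flow-step inequality
(`FlowStep.legKernelNorm_increment_le`) integrates.  Result, from A PRIORI bounds `‖(𝒢_s)_j‖_{wt,ε} ≤ N_j` on the path
(the bootstrap form in which every inductive RG argument is run):

  `‖(𝒢_1 − 𝒢_0)_{m+1}‖_{wt,ε} ≤ ((m+3)(m+2)/2)·c·N_{m+3} + ½·cD·Σ_{a+b=m+1} (a+1)(b+1) N_{a+1} N_{b+1}`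

with `‖C' X Y‖ ≤ c·wt X·wt Y` (loop line: sup norm against the leg weights) and `‖C' X Y‖ ≤ wt X·wt Y·D X Y`,
`ε Σ_Y D ≤ cD`, `ε Σ_X D ≤ cD` (tree line: weighted `L¹` norm).

* `kernel_one_succ`, `weightedKernel_add/_smul/_sub`, `weightedKernel_smul_one_succ` — coefficient-function algebra;
* `hasDerivAt_linearPath`; **`legKernelNorm_effAction_step_le`**; the registered stub.

Sources: M. Salmhofer, *Renormalization* (1999), §4.4 (the integrated RG inequality); M. Salmhofer, CMP 194 (1998) 249,
§4.1 Lemma 1 [`Salmhofer1998`].  Folklore assembly over the tree's `Δ_C` calculus.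
-/

set_option linter.dupNamespace false -- `Summit.<S>.<S>` doubles the summit name (tree convention)

namespace Summit.HubbardSuperconductivity.HubbardSuperconductivity.Theorems.AposterioriCapRgSeededBrokenRegimeBoseFermiPinned

open Literature.MathematicalPhysics.QuantumLattice GrassmannAlgebra

namespace EffActionStep

variable {R : Type*} [CommRing R] [Algebra ℚ R] {Γ : Type*}

/-- The unit has no kernels in positive degree: `kernel 1 (m+1) X = 0` (`∂_Y 1 = 0`). [folklore] -/
theorem kernel_one_succ (m : ℕ) (X : Fin (m + 1) → Γ) : kernel R (1 : GrassmannAlgebra R Γ) (m + 1) X = 0 := by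
  rw [← Fin.cons_self_tail X, kernel_def, KernelCalculus.iterDeriv_cons, Module.End.mul_apply, grassmannDeriv_one,
    map_zero, map_zero, mul_zero]

variable {𝕜 : Type*} [RCLike 𝕜]

/-- Salmhofer's weighted kernels are additive in the polynomial (as coefficient functions). [folklore] -/
theorem weightedKernel_add (ε : ℝ) (F G : GrassmannAlgebra 𝕜 Γ) (m : ℕ) :
    weightedKernel ε (F + G) m = weightedKernel ε F m + weightedKernel ε G m := by
  funext X
  simp only [Pi.add_apply, weightedKernel_def, kernel_add, mul_add]

/-- Salmhofer's weighted kernels are homogeneous in the polynomial (as coefficient functions). [folklore] -/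
theorem weightedKernel_smul (ε : ℝ) (r : 𝕜) (F : GrassmannAlgebra 𝕜 Γ) (m : ℕ) :
    weightedKernel ε (r • F) m = r • weightedKernel ε F m := by
  funext X
  simp only [Pi.smul_apply, weightedKernel_def, kernel_smul, smul_eq_mul]
  ring

/-- Salmhofer's weighted kernels of a difference. [folklore] -/
theorem weightedKernel_sub (ε : ℝ) (F G : GrassmannAlgebra 𝕜 Γ) (m : ℕ) :
    weightedKernel ε (F - G) m = weightedKernel ε F m - weightedKernel ε G m := by
  rw [sub_eq_add_neg, weightedKernel_add, ← neg_one_smul 𝕜 G, weightedKernel_smul, neg_one_smul, ← sub_eq_add_neg]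

/-- A scalar multiple of the unit has no weighted kernels in positive degree. [folklore] -/
theorem weightedKernel_smul_one_succ (ε : ℝ) (r : 𝕜) (m : ℕ) :
    weightedKernel ε (r • (1 : GrassmannAlgebra 𝕜 Γ)) (m + 1) = 0 := by
  funext X
  rw [weightedKernel_smul, Pi.smul_apply, weightedKernel_def, kernel_one_succ, mul_zero, smul_zero, Pi.zero_apply]

/-! ### One integration step of the effective action along a linear covariance path -/

section Step

variable {Γ : Type} [Fintype Γ] [DecidableEq Γ]

omit [Fintype Γ] [DecidableEq Γ] in
/-- The entries of the linear covariance path `s ↦ C₀ + s • C'` have derivative `C'`. [folklore] -/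
theorem hasDerivAt_linearPath (C₀ C' : Matrix Γ Γ ℂ) (s : ℝ) (X Y : Γ) :
    HasDerivAt (fun t : ℝ => (C₀ + (t : ℂ) • C') X Y) (C' X Y) s := by
  simp only [Matrix.add_apply, Matrix.smul_apply, smul_eq_mul]
  have h := ((Complex.ofRealCLM.hasDerivAt (x := s)).mul_const (C' X Y)).const_add (C₀ X Y)
  simpa using h

/-- **One integration step of the Wilsonian effective action in the leg-weighted `L¹–L^∞` norm** (labels in `Type`,
scalars `ℂ`).  Along the linear covariance path `C_s = C₀ + s C'`, `s ∈ [0, 1]`, for an even interaction `V` with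
non-vanishing normalised partition functions, Polchinski's equation (`hasDerivAt_apply_effAction`), the two `L¹–L^∞`
estimates of its right-hand side (`LaplacianNormBound.legKernelNorm_laplacian_le`,
`PolchinskiBilinearBound.legKernelNorm_polchinskiBilinear_le`; the vacuum term `(Ż/Z)·1` has no kernels in positive
degree) and the flow-step inequality (`FlowStep.legKernelNorm_increment_le`) give, from A PRIORI bounds
`‖(𝒢_s)_j‖_{wt,ε} ≤ N_j` on the path, the increment bound in every positive degree `m + 1`:
`‖(𝒢_1 − 𝒢_0)_{m+1}‖ ≤ ((m+3)(m+2)/2)·c·N_{m+3} + ½·cD·Σ_{a+b=m+1} (a+1)(b+1) N_{a+1} N_{b+1}`,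
where `‖C' X Y‖ ≤ c·wt X·wt Y` (loop line) and `‖C' X Y‖ ≤ wt X·wt Y·D X Y`, `εΣD ≤ cD` (tree line) — Salmhofer's
integrated RG inequality for one step, in bootstrap form. [cite: Salmhofer1999, §4.4] -/
theorem legKernelNorm_effAction_step_le {wt : Γ → ℝ} (hwt : ∀ X, 0 ≤ wt X) {ε : ℝ} (hε : 0 < ε)
    (C₀ C' : Matrix Γ Γ ℂ) {V : GrassmannAlgebra ℂ Γ} (hVe : V ∈ GrassmannAlgebra.evenOdd ℂ 0)
    (hZ : ∀ s ∈ Set.Icc (0 : ℝ) 1, effPartitionFn ℂ (C₀ + (s : ℂ) • C') V ≠ 0)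
    {c : ℝ} (hc : 0 ≤ c) (hCc : ∀ X Y, ‖C' X Y‖ ≤ c * (wt X * wt Y))
    (D : Γ → Γ → ℝ) (hD : ∀ X Y, 0 ≤ D X Y) (hCD : ∀ X Y, ‖C' X Y‖ ≤ wt X * wt Y * D X Y)
    {cD : ℝ} (hcD : 0 ≤ cD) (hR : ∀ X, ε * ∑ Y, D X Y ≤ cD) (hCo : ∀ Y, ε * ∑ X, D X Y ≤ cD)
    (N : ℕ → ℝ)
    (hN : ∀ s ∈ Set.Icc (0 : ℝ) 1, ∀ j,
      legKernelNorm wt ε j (weightedKernel ε (effAction ℂ (C₀ + (s : ℂ) • C') V) j) ≤ N j)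
    (m : ℕ) :
    legKernelNorm wt ε (m + 1) (weightedKernel ε (effAction ℂ (C₀ + C') V - effAction ℂ C₀ V) (m + 1)) ≤
      ((m + 3) * (m + 2) / 2 : ℝ) * c * N (m + 3) +
        (1 / 2 : ℝ) * (cD * ∑ a ∈ Finset.range (m + 2), ∑ b ∈ Finset.range (m + 2),
          (if a + b = m + 1 then ((a + 1) * (b + 1) : ℝ) * (N (a + 1) * N (b + 1)) else 0)) := by
  -- the path, the effective action along it, and the right-hand side of Polchinski's equation
  set Cp : ℝ → Matrix Γ Γ ℂ := fun s => C₀ + (s : ℂ) • C' with hCp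
  set 𝒢 : ℝ → GrassmannAlgebra ℂ Γ := fun s => effAction ℂ (Cp s) V with h𝒢
  set Rf : ℝ → GrassmannAlgebra ℂ Γ := fun s =>
    grassmannLaplacian ℂ C' (𝒢 s) -
      (1 / 2 : ℂ) • ∑ X, ∑ Y, C' X Y • (grassmannDeriv ℂ X (𝒢 s) * grassmannDeriv ℂ Y (𝒢 s)) +
      (constPart ℂ (grassmannLaplacian ℂ C' (effBoltzmann ℂ (Cp s) V)) / effPartitionFn ℂ (Cp s) V) • 1 with hRf
  -- Polchinski's equation, weakly, along the path
  have hder : ∀ s ∈ Set.Icc (0 : ℝ) 1, ∀ φ : GrassmannAlgebra ℂ Γ →ₗ[ℂ] ℂ,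
      HasDerivAt (fun t => φ (𝒢 t)) (φ (Rf s)) s :=
    fun s hs φ => hasDerivAt_apply_effAction Cp C' s (hasDerivAt_linearPath C₀ C' s) hVe (hZ s hs) φ
  -- nonnegativity of the summands of the bound
  have hN0 : ∀ s ∈ Set.Icc (0 : ℝ) 1, ∀ j, 0 ≤ N j :=
    fun s hs j => (legKernelNorm_nonneg hwt hε.le j _).trans (hN s hs j)
  have h0mem : (0 : ℝ) ∈ Set.Icc (0 : ℝ) 1 := Set.left_mem_Icc.2 zero_le_one
  -- the bound on the right-hand side in degree `m + 1`
  set Bv : ℝ := ((m + 3) * (m + 2) / 2 : ℝ) * c * N (m + 3) +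
    (1 / 2 : ℝ) * (cD * ∑ a ∈ Finset.range (m + 2), ∑ b ∈ Finset.range (m + 2),
      (if a + b = m + 1 then ((a + 1) * (b + 1) : ℝ) * (N (a + 1) * N (b + 1)) else 0)) with hBv
  have hB : ∀ s ∈ Set.Icc (0 : ℝ) 1, legKernelNorm wt ε (m + 1) (weightedKernel ε (Rf s) (m + 1)) ≤ Bv := by
    intro s hs
    -- kernels of the three terms
    have hsplit : weightedKernel ε (Rf s) (m + 1) =
        weightedKernel ε (grassmannLaplacian ℂ C' (𝒢 s)) (m + 1) +
          (-(1 / 2 : ℂ)) • weightedKernel ε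
            (∑ X, ∑ Y, C' X Y • (grassmannDeriv ℂ X (𝒢 s) * grassmannDeriv ℂ Y (𝒢 s))) (m + 1) := by
      rw [hRf]
      simp only []
      rw [weightedKernel_add, weightedKernel_smul_one_succ, add_zero, weightedKernel_sub, weightedKernel_smul,
        sub_eq_add_neg, ← neg_smul]
    rw [hsplit]
    refine (LegKernelNormAlgebra.legKernelNorm_add_le hwt hε.le _ _ _).trans (add_le_add ?_ ?_)
    · -- the contraction term
      refine (LaplacianNormBound.legKernelNorm_laplacian_le hwt hε C' c hCc (𝒢 s) m).trans ?_
      exact mul_le_mul_of_nonneg_left (hN s hs (m + 3)) (mul_nonneg (by positivity) hc)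
    · -- the bilinear term
      rw [LegKernelNormSmul.legKernelNorm_smul, norm_neg]
      have hhalf : ‖(1 / 2 : ℂ)‖ = (1 / 2 : ℝ) := by simp
      rw [hhalf]
      refine mul_le_mul_of_nonneg_left ?_ (by norm_num)
      refine (PolchinskiBilinearBound.legKernelNorm_polchinskiBilinear_le hwt hε C' D hD hCD cD hR hCo
        (𝒢 s) (𝒢 s) m).trans (mul_le_mul_of_nonneg_left ?_ hcD)
      refine Finset.sum_le_sum fun a _ => Finset.sum_le_sum fun b _ => ?_
      split_ifs
      · exact mul_le_mul_of_nonneg_left (mul_le_mul (hN s hs (a + 1)) (hN s hs (b + 1))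
          (legKernelNorm_nonneg hwt hε.le _ _) (hN0 s hs (a + 1))) (by positivity)
      · exact le_rfl
  -- the flow-step inequality over `[0, 1]`
  have hstep := FlowStep.legKernelNorm_increment_le hwt hε.le 𝒢 Rf zero_le_one hder (m + 1) hB
  have h1 : 𝒢 1 = effAction ℂ (C₀ + C') V := by simp only [h𝒢, hCp, Complex.ofReal_one, one_smul]
  have h0 : 𝒢 0 = effAction ℂ C₀ V := by simp only [h𝒢, hCp, Complex.ofReal_zero, zero_smul, add_zero]
  rw [h1, h0, sub_zero, one_mul] at hstep
  exact hstep

end Step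

end EffActionStep

/-! ### The registered stub -/

/-- **W10 (`stub_effActionStepLe`) — one RG integration step in the report's norm**: along `C_s = C₀ + sC'`,
`s ∈ [0,1]`, for an even interaction with non-vanishing normalised partition functions and a priori bounds
`‖(𝒢_s)_j‖_{wt,ε} ≤ N_j`, the increment of the Wilsonian effective action obeys
`‖(𝒢_1 − 𝒢_0)_{m+1}‖_{wt,ε} ≤ ((m+3)(m+2)/2)·c·N_{m+3} + ½·cD·Σ_{a+b=m+1}(a+1)(b+1)N_{a+1}N_{b+1}`
(Polchinski's equation + the `L¹–L^∞` estimates of its two terms + the flow-step inequality). [cite: Salmhofer1999, §4.4] -/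
theorem stub_effActionStepLe :
    ∀ {Γ : Type} [Fintype Γ] [DecidableEq Γ] (wt : Γ → ℝ), (∀ X, 0 ≤ wt X) → ∀ {ε : ℝ}, 0 < ε →
      ∀ (C₀ C' : Matrix Γ Γ ℂ) (V : GrassmannAlgebra ℂ Γ), V ∈ GrassmannAlgebra.evenOdd ℂ 0 →
        (∀ s ∈ Set.Icc (0 : ℝ) 1, effPartitionFn ℂ (C₀ + (s : ℂ) • C') V ≠ 0) →
        ∀ (c : ℝ), 0 ≤ c → (∀ X Y, ‖C' X Y‖ ≤ c * (wt X * wt Y)) →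
        ∀ (D : Γ → Γ → ℝ), (∀ X Y, 0 ≤ D X Y) → (∀ X Y, ‖C' X Y‖ ≤ wt X * wt Y * D X Y) →
        ∀ (cD : ℝ), 0 ≤ cD → (∀ X, ε * ∑ Y, D X Y ≤ cD) → (∀ Y, ε * ∑ X, D X Y ≤ cD) →
        ∀ (N : ℕ → ℝ), (∀ s ∈ Set.Icc (0 : ℝ) 1, ∀ j : ℕ,
            legKernelNorm wt ε j (weightedKernel ε (effAction ℂ (C₀ + (s : ℂ) • C') V) j) ≤ N j) →
        ∀ m : ℕ,
          legKernelNorm wt ε (m + 1) (weightedKernel ε (effAction ℂ (C₀ + C') V - effAction ℂ C₀ V) (m + 1)) ≤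
            ((m + 3) * (m + 2) / 2 : ℝ) * c * N (m + 3) +
              (1 / 2 : ℝ) * (cD * ∑ a ∈ Finset.range (m + 2), ∑ b ∈ Finset.range (m + 2),
                (if a + b = m + 1 then ((a + 1) * (b + 1) : ℝ) * (N (a + 1) * N (b + 1)) else 0)) := by
  intro Γ _ _ wt hwt ε hε C₀ C' V hVe hZ c hc hCc D hD hCD cD hcD hR hCo N hN m
  exact EffActionStep.legKernelNorm_effAction_step_le hwt hε C₀ C' hVe hZ hc hCc D hD hCD hcD hR hCo N hN m

end Summit.HubbardSuperconductivity.HubbardSuperconductivity.Theorems.AposterioriCapRgSeededBrokenRegimeBoseFermiPinned
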